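import Literature.Analysis.FunctionSpaces.TorusHolderBridge
import Literature.Analysis.FunctionSpaces.TorusEnstrophyOrthogonality
import HarnessLib

/-!
# Pointwise sizes of convective terms and Laplacians; Hölder norms by interpolation (tools for Cheskidov 2023, §3)

Topic `Literature/Analysis/FluidPDE` (family `turb`). Elementary calculus on the flat torus used by
the gluing estimates behind `Literature.Analysis.FluidPDE.cheskidov_noAnomaly_family`
(Cheskidov, arXiv:2311.04182, §3 (3.11)–(3.13); Bruè–De Lellis, CMP 400 (2023), Lemma 5.1), kept
separate because nothing here refers to the gluing:

* the partial derivatives `∂ᵢ[(u·∇)w] = ∑ⱼ (∂ᵢuⱼ ∂ⱼw + uⱼ ∂ᵢ∂ⱼw)` of the convective term (in the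
  coordinates of `Torus.convect_eq_sum_smul_partialDeriv`), the scaling `((a u)·∇)(b w) = ab (u·∇)w`,
  `∂ⱼΔf = ∑ᵢ ∂ⱼ∂ᵢ∂ᵢf`, and the resulting
  pointwise SIZE bounds in terms of sup bounds on partial derivatives
  (`norm_convect_le`, `norm_partialDeriv_convect_le`, `norm_laplacian_le`,
  `norm_partialDeriv_laplacian_le`);
* **interpolation** `[g]_r ≤ Lip(g)^r (2‖g‖_∞)^{1-r}` (`LipschitzWith.holderWith_rpow`, deliberately
  in Mathlib's `LipschitzWith` namespace for dot notation) and its torus form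
  `‖g‖_∞ + [g]_r ≤ M + (√d · d L)^r (2M)^{1-r}` from `‖g‖ ≤ M`, `‖∂ᵢg‖ ≤ L`
  (`eBoundedHolderNorm_le_interp`) — this is what makes `poly(n) λₙ^{α-1} → 0` for every `α < 1`
  in BDL Lemma 5.1 without fractional derivatives;
* **partial derivatives lower the `C^{k,r}` index**: `‖∂ᵢg‖_{C^{k,r}} ≤ ‖g‖_{C^{k+1,r}}`
  (`eContDiffHolderNorm_partialDeriv_le`, via `Dʲ(a ↦ DG(a)e)(x) m = Dʲ⁺¹G(x)(snoc m e)`), whence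
  pointwise bounds on partial derivatives up to order three from the `C^{k,0}` bounds printed in
  Cheskidov 2023, Thm. 3.1 (a) / Bruè–De Lellis 2023, Thm. 4.1 (a).

## References

* D. Gilbarg, N. S. Trudinger, *Elliptic Partial Differential Equations of Second Order*, §4.1
  ((4.4)–(4.6): the `C^{k,α}` norms; interpolation of Hölder seminorms).
* A. Cheskidov, arXiv:2311.04182 (2023), Thm. 3.1 (a), (3.11)–(3.13).
* E. Bruè, C. De Lellis, Comm. Math. Phys. 400 (2023), Thm. 4.1 (a), Lemma 5.1.
-/

noncomputable section

open MeasureTheory Set Filter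
open _root_.Topology
open scoped ENNReal NNReal ContDiff

namespace Literature.Analysis.FluidPDE.Gluing

open Literature.Analysis.FunctionSpaces

/-! ## Pointwise calculus on the torus: convective terms, Laplacians, and their sizes -/

section Calculus

variable {d : Type*} [Fintype d] [DecidableEq d] {F : Type*} [NormedAddCommGroup F] [NormedSpace ℝ F]

omit [DecidableEq d] in
/-- Scaling of the convective derivative: `((a u)·∇)(b w) = a b (u·∇)w`. [folklore] -/
theorem convect_smul_smul {u : UnitAddTorus d → EuclideanSpace ℝ d} {w : UnitAddTorus d → F}
    (hw : Torus.IsContDiff 1 w) (a b : ℝ) (x : UnitAddTorus d) :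
    Torus.convect (fun y => a • u y) (fun y => b • w y) x = (a * b) • Torus.convect u w x := by
  unfold Torus.convect
  rw [show (fun y => b • w y) = b • w from rfl, Torus.fderiv_const_smul hw,
    FunLike.coe_smul, Pi.smul_apply, map_smul, smul_smul, mul_comm]

/-- Size of the convective derivative: `‖(u·∇)w (x)‖ ≤ d ‖u(x)‖ maxⱼ‖∂ⱼw(x)‖`. [folklore] -/
theorem norm_convect_le {u : UnitAddTorus d → EuclideanSpace ℝ d} {w : UnitAddTorus d → F}
    (hw : Torus.IsContDiff 1 w) {x : UnitAddTorus d} {L : ℝ} (hL : ∀ j, ‖Torus.partialDeriv j w x‖ ≤ L) :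
    ‖Torus.convect u w x‖ ≤ Fintype.card d * (‖u x‖ * L) := by
  rw [Torus.convect_eq_sum_smul_partialDeriv hw]
  refine (norm_sum_le _ _).trans ?_
  have : ∀ j, ‖u x j • Torus.partialDeriv j w x‖ ≤ ‖u x‖ * L := fun j => by
    rw [norm_smul]
    exact mul_le_mul (by simpa using PiLp.norm_apply_le (u x) j) (hL j) (norm_nonneg _) (norm_nonneg _)
  calc ∑ j, ‖u x j • Torus.partialDeriv j w x‖ ≤ ∑ _j : d, ‖u x‖ * L := Finset.sum_le_sum fun j _ => this j
    _ = Fintype.card d * (‖u x‖ * L) := by simp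

/-- Partial derivatives of the convective derivative: `∂ᵢ[(u·∇)w] = ∑ⱼ (∂ᵢuⱼ ∂ⱼw + uⱼ ∂ᵢ∂ⱼw)`. [folklore] -/
theorem partialDeriv_convect {u : UnitAddTorus d → EuclideanSpace ℝ d} {w : UnitAddTorus d → F}
    (hu : Torus.IsSmooth u) (hw : Torus.IsSmooth w) (i : d) (x : UnitAddTorus d) :
    Torus.partialDeriv i (Torus.convect u w) x =
      ∑ j, (Torus.partialDeriv i u x j • Torus.partialDeriv j w x +
        u x j • Torus.partialDeriv i (Torus.partialDeriv j w) x) := by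
  have hw1 : Torus.IsContDiff 1 w := hw.isContDiff (by simp)
  have heq : Torus.convect u w = fun y => ∑ j, u y j • Torus.partialDeriv j w y := funext (Torus.convect_eq_sum_smul_partialDeriv hw1)
  have hu1 : ∀ j, Torus.IsContDiff 1 (fun y => u y j) := fun j => (hu.apply j).isContDiff (by simp)
  have hpw : ∀ j, Torus.IsContDiff 1 (Torus.partialDeriv j w) := fun j => (hw.partialDeriv j).isContDiff (by simp)
  have hsm : ∀ j, Torus.IsContDiff 1 (fun y => u y j • Torus.partialDeriv j w y) := fun j => by
    change ContDiff ℝ 1 (fun z => u (Torus.proj z) j • Torus.partialDeriv j w (Torus.proj z))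
    exact ContDiff.smul (hu1 j) (hpw j)
  rw [heq, Torus.partialDeriv_finset_sum _ (fun j _ => hsm j) i x]
  refine Finset.sum_congr rfl fun j _ => ?_
  rw [Torus.partialDeriv_smul' (hu1 j) (hpw j), Torus.partialDeriv_apply_coord (hu.isContDiff (by simp))]

/-- Size of the partial derivatives of the convective derivative. [folklore] -/
theorem norm_partialDeriv_convect_le {u : UnitAddTorus d → EuclideanSpace ℝ d} {w : UnitAddTorus d → F}
    (hu : Torus.IsSmooth u) (hw : Torus.IsSmooth w) {i : d} {x : UnitAddTorus d} {Mu Lu Lw L2w : ℝ}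
    (hMu : ‖u x‖ ≤ Mu) (hLu : ‖Torus.partialDeriv i u x‖ ≤ Lu) (hLw : ∀ j, ‖Torus.partialDeriv j w x‖ ≤ Lw)
    (hL2w : ∀ j, ‖Torus.partialDeriv i (Torus.partialDeriv j w) x‖ ≤ L2w) :
    ‖Torus.partialDeriv i (Torus.convect u w) x‖ ≤ Fintype.card d * (Lu * Lw + Mu * L2w) := by
  rw [partialDeriv_convect hu hw]
  refine (norm_sum_le _ _).trans ?_
  have hLu0 : 0 ≤ Lu := (norm_nonneg _).trans hLu
  have hMu0 : 0 ≤ Mu := (norm_nonneg _).trans hMu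
  have : ∀ j, ‖Torus.partialDeriv i u x j • Torus.partialDeriv j w x +
      u x j • Torus.partialDeriv i (Torus.partialDeriv j w) x‖ ≤ Lu * Lw + Mu * L2w := fun j => by
    refine (norm_add_le _ _).trans (add_le_add ?_ ?_)
    · rw [norm_smul]
      exact mul_le_mul ((by simpa using PiLp.norm_apply_le (Torus.partialDeriv i u x) j :
        ‖Torus.partialDeriv i u x j‖ ≤ ‖Torus.partialDeriv i u x‖).trans hLu) (hLw j) (norm_nonneg _) hLu0
    · rw [norm_smul]
      exact mul_le_mul ((by simpa using PiLp.norm_apply_le (u x) j : ‖u x j‖ ≤ ‖u x‖).trans hMu)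
        (hL2w j) (norm_nonneg _) hMu0
  calc _ ≤ ∑ _j : d, (Lu * Lw + Mu * L2w) := Finset.sum_le_sum fun j _ => this j
    _ = _ := by simp only [Finset.sum_const, Finset.card_univ, nsmul_eq_mul]

/-- Size of the Laplacian: `‖Δf(x)‖ ≤ d maxᵢ‖∂ᵢ∂ᵢf(x)‖`. [folklore] -/
theorem norm_laplacian_le {f : UnitAddTorus d → F} (hf : Torus.IsSmooth f) {x : UnitAddTorus d} {L : ℝ}
    (hL : ∀ i, ‖Torus.partialDeriv i (Torus.partialDeriv i f) x‖ ≤ L) :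
    ‖Torus.laplacian f x‖ ≤ Fintype.card d * L := by
  rw [Torus.laplacian_eq_sum_partialDeriv_partialDeriv hf]
  refine (norm_sum_le _ _).trans ?_
  calc _ ≤ ∑ _i : d, L := Finset.sum_le_sum fun i _ => hL i
    _ = _ := by simp

/-- Partial derivatives of the Laplacian: `∂ⱼΔf = ∑ᵢ ∂ⱼ∂ᵢ∂ᵢ f` for smooth `f`. [folklore] -/
theorem partialDeriv_laplacian {f : UnitAddTorus d → F} (hf : Torus.IsSmooth f) (j : d) (x : UnitAddTorus d) :
    Torus.partialDeriv j (Torus.laplacian f) x =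
      ∑ i, Torus.partialDeriv j (Torus.partialDeriv i (Torus.partialDeriv i f)) x := by
  have heq : Torus.laplacian f = fun y => ∑ i, Torus.partialDeriv i (Torus.partialDeriv i f) y :=
    funext (Torus.laplacian_eq_sum_partialDeriv_partialDeriv hf)
  rw [heq, Torus.partialDeriv_finset_sum]
  exact fun i _ => ((hf.partialDeriv i).partialDeriv i).isContDiff (by simp)

/-- Size of the partial derivatives of the Laplacian. [folklore] -/
theorem norm_partialDeriv_laplacian_le {f : UnitAddTorus d → F} (hf : Torus.IsSmooth f) {j : d}
    {x : UnitAddTorus d} {L : ℝ}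
    (hL : ∀ i, ‖Torus.partialDeriv j (Torus.partialDeriv i (Torus.partialDeriv i f)) x‖ ≤ L) :
    ‖Torus.partialDeriv j (Torus.laplacian f) x‖ ≤ Fintype.card d * L := by
  rw [partialDeriv_laplacian hf]
  refine (norm_sum_le _ _).trans ?_
  calc _ ≤ ∑ _i : d, L := Finset.sum_le_sum fun i _ => hL i
    _ = _ := by simp

end Calculus

/-! ## Hölder norms by interpolation between a sup bound and a Lipschitz bound -/

section Holder

/-- **Interpolation**: a map with `‖g‖ ≤ M` and Lipschitz constant `K` is `r`-Hölder with constant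
`K^r (2M)^{1-r}` for `r ≤ 1` (`min(K δ, 2M) ≤ (Kδ)^r (2M)^{1-r}`). [folklore] -/
theorem _root_.LipschitzWith.holderWith_rpow {X G : Type*} [PseudoMetricSpace X]
    [SeminormedAddCommGroup G] {K M r : ℝ≥0} {g : X → G} (hK : LipschitzWith K g)
    (hM : ∀ x, ‖g x‖₊ ≤ M) (hr : r ≤ 1) :
    HolderWith (K ^ (r : ℝ) * (2 * M) ^ (1 - (r : ℝ))) r g := by
  intro x y
  have hr0 : 0 ≤ (r : ℝ) := r.2
  have h1r : 0 ≤ 1 - (r : ℝ) := by simpa using hr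
  have hLip : nndist (g x) (g y) ≤ K * nndist x y := by
    rw [← NNReal.coe_le_coe, NNReal.coe_mul, coe_nndist, coe_nndist]
    exact hK.dist_le_mul x y
  have hBd : nndist (g x) (g y) ≤ 2 * M := by
    rw [nndist_eq_nnnorm, two_mul]
    exact (nnnorm_sub_le _ _).trans (add_le_add (hM x) (hM y))
  have aux : ∀ {a b c : ℝ≥0}, c ≤ a → c ≤ b → c ≤ a ^ (r : ℝ) * b ^ (1 - (r : ℝ)) := by
    intro a b c hca hcb
    have hsplit : ∀ e : ℝ≥0, e = e ^ (r : ℝ) * e ^ (1 - (r : ℝ)) := fun e => by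
      rw [← NNReal.rpow_add' (by norm_num : (r : ℝ) + (1 - (r : ℝ)) ≠ 0)]
      norm_num
    rcases le_total a b with h | h
    · calc c ≤ a := hca
        _ = a ^ (r : ℝ) * a ^ (1 - (r : ℝ)) := hsplit a
        _ ≤ a ^ (r : ℝ) * b ^ (1 - (r : ℝ)) := by
          gcongr
    · calc c ≤ b := hcb
        _ = b ^ (r : ℝ) * b ^ (1 - (r : ℝ)) := hsplit b
        _ ≤ a ^ (r : ℝ) * b ^ (1 - (r : ℝ)) := by
          gcongr
  have key : nndist (g x) (g y) ≤ (K ^ (r : ℝ) * (2 * M) ^ (1 - (r : ℝ))) * nndist x y ^ (r : ℝ) := by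
    have := aux hLip hBd
    rwa [NNReal.mul_rpow, mul_right_comm] at this
  calc edist (g x) (g y) = (nndist (g x) (g y) : ℝ≥0∞) := edist_nndist _ _
    _ ≤ ((K ^ (r : ℝ) * (2 * M) ^ (1 - (r : ℝ))) * nndist x y ^ (r : ℝ) : ℝ≥0) :=
        ENNReal.coe_le_coe.2 key
    _ = ((K ^ (r : ℝ) * (2 * M) ^ (1 - (r : ℝ)) : ℝ≥0) : ℝ≥0∞) * edist x y ^ (r : ℝ) := by
        rw [ENNReal.coe_mul, ENNReal.coe_rpow_of_nonneg _ hr0, edist_nndist]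

variable {d : Type*} [Fintype d] [DecidableEq d] {Y : Type*} [NormedAddCommGroup Y] [NormedSpace ℝ Y]

/-- **`C^{0,r}` bound by interpolation on the torus.** For a `C¹` map `g` on `T^d` with
`‖g‖_∞ ≤ M` and `‖∂ᵢg‖_∞ ≤ L`, and `r ≤ 1`:
`‖g‖_∞ + [g]_r ≤ M + (√d · d L)^r (2M)^{1-r}`. [folklore] -/
theorem eBoundedHolderNorm_le_interp {g : UnitAddTorus d → Y} (hg : Torus.IsContDiff 1 g)
    {r : ℝ≥0} (hr : r ≤ 1) {M L : ℝ} (hM : 0 ≤ M) (hL : 0 ≤ L) (h0 : ∀ x, ‖g x‖ ≤ M)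
    (h1 : ∀ i x, ‖Torus.partialDeriv i g x‖ ≤ L) :
    eBoundedHolderNorm r g ≤
      ENNReal.ofReal (M + (Real.sqrt (Fintype.card d) * (Fintype.card d * L)) ^ (r : ℝ) *
        (2 * M) ^ (1 - (r : ℝ))) := by
  have hLip := Torus.lipschitzWith_of_norm_partialDeriv_le hg (M := fun _ => L.toNNReal)
    (fun i x => (h1 i x).trans (Real.le_coe_toNNReal L))
  have hMx : ∀ x, ‖g x‖₊ ≤ M.toNNReal := fun x => by
    rw [← NNReal.coe_le_coe, coe_nnnorm]; exact (h0 x).trans (Real.le_coe_toNNReal M)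
  have hH := hLip.holderWith_rpow hMx hr
  have hsup : eSupNorm g ≤ ENNReal.ofReal M :=
    iSup_le fun x => by rw [← ofReal_norm]; exact ENNReal.ofReal_le_ofReal (h0 x)
  rw [eBoundedHolderNorm]
  refine (add_le_add hsup hH.eHolderNorm_le).trans ?_
  have hsum : (∑ _i : d, L.toNNReal) = (Fintype.card d : ℝ≥0) * L.toNNReal := by simp
  rw [hsum, ← ENNReal.ofReal_coe_nnreal, ← ENNReal.ofReal_add hM (NNReal.coe_nonneg _)]
  refine ENNReal.ofReal_le_ofReal (add_le_add le_rfl (le_of_eq ?_))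
  rw [NNReal.coe_mul, NNReal.coe_rpow, NNReal.coe_rpow]
  push_cast
  rw [Real.coe_toNNReal L hL, Real.coe_toNNReal M hM]

end Holder

/-! ## From `C^{k,r}` bounds to pointwise bounds on partial derivatives -/

section HolderToPointwise

variable {E' Y : Type*} [NormedAddCommGroup E'] [NormedSpace ℝ E'] [NormedAddCommGroup Y] [NormedSpace ℝ Y]

/-- Directional derivatives lower the order: pointwise,
`‖Dʲ(a ↦ DG(a) e)(x) m‖ = ‖Dʲ⁺¹G(x) (snoc m e)‖`. [folklore] -/
theorem iteratedFDeriv_fderiv_apply_eq {G : E' → Y} {j : ℕ} (hG : ContDiff ℝ (j + 1) G) (e x : E')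
    (m : Fin j → E') :
    iteratedFDeriv ℝ j (fun a => fderiv ℝ G a e) x m = iteratedFDeriv ℝ (j + 1) G x (Fin.snoc m e) := by
  have hc : ContDiff ℝ j (fderiv ℝ G) := hG.fderiv_right le_rfl
  rw [iteratedFDeriv_clm_apply_const_apply hc le_rfl, iteratedFDeriv_succ_apply_right,
    Fin.init_snoc, Fin.snoc_last]

/-- Directional derivatives lower the order, sup norms: `‖Dʲ(a ↦ DG(a) e)(x)‖ ≤ ‖e‖ ‖Dʲ⁺¹G(x)‖`. [folklore] -/
theorem norm_iteratedFDeriv_fderiv_apply_le {G : E' → Y} {j : ℕ} (hG : ContDiff ℝ (j + 1) G)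
    (e x : E') :
    ‖iteratedFDeriv ℝ j (fun a => fderiv ℝ G a e) x‖ ≤ ‖e‖ * ‖iteratedFDeriv ℝ (j + 1) G x‖ := by
  refine ContinuousMultilinearMap.opNorm_le_bound (by positivity) fun m => ?_
  rw [iteratedFDeriv_fderiv_apply_eq hG]
  refine (ContinuousMultilinearMap.le_opNorm _ _).trans (le_of_eq ?_)
  rw [Fin.prod_univ_castSucc]
  simp only [Fin.snoc_castSucc, Fin.snoc_last]
  ring

/-- Directional derivatives lower the order, increments:
`‖Dʲ(a ↦ DG(a) e)(x) - Dʲ(a ↦ DG(a) e)(y)‖ ≤ ‖e‖ ‖Dʲ⁺¹G(x) - Dʲ⁺¹G(y)‖`. [folklore] -/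
theorem norm_iteratedFDeriv_fderiv_apply_sub_le {G : E' → Y} {j : ℕ} (hG : ContDiff ℝ (j + 1) G)
    (e x y : E') :
    ‖iteratedFDeriv ℝ j (fun a => fderiv ℝ G a e) x - iteratedFDeriv ℝ j (fun a => fderiv ℝ G a e) y‖ ≤
      ‖e‖ * ‖iteratedFDeriv ℝ (j + 1) G x - iteratedFDeriv ℝ (j + 1) G y‖ := by
  refine ContinuousMultilinearMap.opNorm_le_bound (by positivity) fun m => ?_
  rw [sub_apply, iteratedFDeriv_fderiv_apply_eq hG, iteratedFDeriv_fderiv_apply_eq hG, ← sub_apply]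
  refine (ContinuousMultilinearMap.le_opNorm _ _).trans (le_of_eq ?_)
  rw [Fin.prod_univ_castSucc]
  simp only [Fin.snoc_castSucc, Fin.snoc_last]
  ring

variable {d : Type*} [Fintype d] [DecidableEq d]

/-- **Partial derivatives lower the `C^{k,r}` index**: `‖∂ᵢg‖_{C^{k,r}} ≤ ‖g‖_{C^{k+1,r}}` for
smooth `g` on `T^d` (Gilbarg–Trudinger §4.1, (4.4): the `C^{k,α}` norms are nested sums over
all derivatives up to order `k`). [folklore] -/
theorem eContDiffHolderNorm_partialDeriv_le {g : UnitAddTorus d → Y} (hg : Torus.IsSmooth g) (i : d)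
    (k : ℕ) (r : ℝ≥0) :
    Torus.eContDiffHolderNorm k r (Torus.partialDeriv i g) ≤ Torus.eContDiffHolderNorm (k + 1) r g := by
  have he : ‖(EuclideanSpace.single i (1 : ℝ) : EuclideanSpace ℝ d)‖ = 1 := by simp
  have hlift := Torus.lift_partialDeriv_eq (hg.isContDiff (by simp)) i
  have hG : ∀ j : ℕ, ContDiff ℝ (j + 1) (Torus.lift g) := fun j => hg.of_le (by exact_mod_cast le_top)
  have hsup : ∀ j : ℕ, eSupNorm (iteratedFDeriv ℝ j (Torus.lift (Torus.partialDeriv i g))) ≤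
      eSupNorm (iteratedFDeriv ℝ (j + 1) (Torus.lift g)) := fun j => by
    rw [hlift]
    refine eSupNorm_le_of_norm_le fun x => ?_
    have := norm_iteratedFDeriv_fderiv_apply_le (hG j) (EuclideanSpace.single i (1 : ℝ)) x
    rwa [he, one_mul] at this
  have hhol : eHolderNorm r (iteratedFDeriv ℝ k (Torus.lift (Torus.partialDeriv i g))) ≤
      eHolderNorm r (iteratedFDeriv ℝ (k + 1) (Torus.lift g)) := by
    rw [hlift]
    refine eHolderNorm_le_of_edist_le fun x y => ?_
    rw [edist_eq_enorm_sub, edist_eq_enorm_sub, ← ofReal_norm, ← ofReal_norm]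
    refine ENNReal.ofReal_le_ofReal ?_
    have := norm_iteratedFDeriv_fderiv_apply_sub_le (hG k) (EuclideanSpace.single i (1 : ℝ)) x y
    rwa [he, one_mul] at this
  unfold Torus.eContDiffHolderNorm eContDiffHolderNorm
  rw [Finset.sum_range_succ' (fun j => eSupNorm (iteratedFDeriv ℝ j (Torus.lift g)))]
  calc (∑ j ∈ Finset.range (k + 1), eSupNorm (iteratedFDeriv ℝ j (Torus.lift (Torus.partialDeriv i g)))) +
        eHolderNorm r (iteratedFDeriv ℝ k (Torus.lift (Torus.partialDeriv i g)))
      ≤ (∑ j ∈ Finset.range (k + 1), eSupNorm (iteratedFDeriv ℝ (j + 1) (Torus.lift g))) +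
        eHolderNorm r (iteratedFDeriv ℝ (k + 1) (Torus.lift g)) :=
        add_le_add (Finset.sum_le_sum fun j _ => hsup j) hhol
    _ ≤ _ := add_le_add le_self_add le_rfl

omit [DecidableEq d] in
omit [NormedSpace ℝ Y] in
/-- From a bound `eSupNorm f ≤ ofReal c` to the pointwise bound `‖f x‖ ≤ max c 0`. [folklore] -/
theorem norm_le_of_eSupNorm_le {Z : Type*} {f : Z → Y} {c : ℝ} (h : eSupNorm f ≤ ENNReal.ofReal c) (x : Z) :
    ‖f x‖ ≤ max c 0 := by
  have h1 : ‖f x‖ₑ ≤ ENNReal.ofReal c := (enorm_le_eSupNorm f x).trans h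
  have h2 := ENNReal.toReal_mono ENNReal.ofReal_ne_top h1
  rwa [toReal_enorm, ENNReal.toReal_ofReal'] at h2

omit [DecidableEq d] in
/-- Sup bound from a `C^{0,r}` bound. [folklore] -/
theorem norm_le_of_eContDiffHolderNorm_zero_le {g : UnitAddTorus d → Y} {r : ℝ≥0} {c : ℝ}
    (h : Torus.eContDiffHolderNorm 0 r g ≤ ENNReal.ofReal c) (x : UnitAddTorus d) : ‖g x‖ ≤ max c 0 :=
  norm_le_of_eSupNorm_le ((Torus.eSupNorm_le_eContDiffHolderNorm_zero g r).trans h) x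

/-- First partial derivatives from a `C^{1,r}` bound. [folklore] -/
theorem norm_partialDeriv_le_of_eContDiffHolderNorm_one_le {g : UnitAddTorus d → Y} (hg : Torus.IsSmooth g)
    {r : ℝ≥0} {c : ℝ} (h : Torus.eContDiffHolderNorm 1 r g ≤ ENNReal.ofReal c) (i : d) (x : UnitAddTorus d) :
    ‖Torus.partialDeriv i g x‖ ≤ max c 0 :=
  norm_le_of_eSupNorm_le ((Torus.eSupNorm_partialDeriv_le (hg.isContDiff (by simp)) i r).trans h) x

/-- Second partial derivatives from a `C^{2,r}` bound. [folklore] -/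
theorem norm_partialDeriv_partialDeriv_le_of_eContDiffHolderNorm_two_le {g : UnitAddTorus d → Y}
    (hg : Torus.IsSmooth g) {r : ℝ≥0} {c : ℝ} (h : Torus.eContDiffHolderNorm 2 r g ≤ ENNReal.ofReal c)
    (i j : d) (x : UnitAddTorus d) : ‖Torus.partialDeriv i (Torus.partialDeriv j g) x‖ ≤ max c 0 :=
  norm_le_of_eSupNorm_le (((Torus.eSupNorm_partialDeriv_le ((hg.partialDeriv j).isContDiff (by simp)) i r).trans
    (eContDiffHolderNorm_partialDeriv_le hg j 1 r)).trans h) x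

/-- Third partial derivatives from a `C^{3,r}` bound. [folklore] -/
theorem norm_partialDeriv_partialDeriv_partialDeriv_le_of_eContDiffHolderNorm_three_le
    {g : UnitAddTorus d → Y} (hg : Torus.IsSmooth g) {r : ℝ≥0} {c : ℝ}
    (h : Torus.eContDiffHolderNorm 3 r g ≤ ENNReal.ofReal c) (i j l : d) (x : UnitAddTorus d) :
    ‖Torus.partialDeriv i (Torus.partialDeriv j (Torus.partialDeriv l g)) x‖ ≤ max c 0 :=
  norm_le_of_eSupNorm_le ((((Torus.eSupNorm_partialDeriv_le (((hg.partialDeriv l).partialDeriv j).isContDiff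
    (by simp)) i r).trans (eContDiffHolderNorm_partialDeriv_le (hg.partialDeriv l) j 1 r)).trans
    (eContDiffHolderNorm_partialDeriv_le hg l 2 r)).trans h) x

end HolderToPointwise

end Literature.Analysis.FluidPDE.Gluing

end
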